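import Summits.Ventures.HodgeRepro.Night1ReducedExceptional

/-!
# The reduced lines of a face are exceptional on the coset `G`-set of `B_red` — the model of the actual
CM algebra `∏_k E^{rstab (Φ k)}` of the reduced product (Lemma R's CM-algebra side)

Blind re-derivation cell `pub-hodge-repro`, seat `night-1` (gen 5, twelfth file).  Imports night-1's
`Night1ReducedExceptional` and, through the chain, gen 0's coset model `RouteCCosetModel`
(`cosetSet Φ = Σ k, G ⧸ rstab (Φ k)`, `cosetMap`, `cosetType`, `mk_mem_cosetType_iff`), gen 3's
`cosetEnum` / `cosetEnum_injective` (`Night1ReducedLevelK`), and gen 0's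
`injOn_cosetMap_reducedSet_of_injective` (`RouteCClauses`).

`Night1ReducedExceptional` works on `J × G` (one copy of `G` per isogeny class — the product of the
representatives `∏_k A_{Φ k}`); Lemma R's CM-algebra side (gen 0's H3) works on the coset `G`-set of the
reduced product `B_red = ∏_k Simple(Φ k)`, whose CM algebra is `∏_k E^{rstab (Φ k)}` with embeddings
`⊔_k G ⧸ rstab (Φ k)`.  The class C5′ must make algebraic is the coordinate wedge of `cosetMap Φ (U_σ)`
(gen 3's `cosetEnum`, the level-`k` form of gen 0's `weilEnum`).  This file checks that it is exceptional
there too: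

* `cosetMap_mem_smul_cosetType_iff` — `⟨k, y · rstab⟩ ∈ g • cosetType Φ ↔ g⁻¹ y ∈ Φ k`;
* `eq_compl_of_balanced_pair_coset` — a balanced pair of `cosetMap Φ (U_σ)` comes from complementary
  corners;
* **`coordWedgeOn_cosetEnum_notMem_divisorPowerIn`** — with no two corners complementary (and `cosetMap`
  injective on `U_σ`, automatic for distinct corners) the class is not a `k`-fold product of divisor
  classes of `B_red`;
* **`FaceData.coset_exceptional`** — for every face record passing its checks in degree `> 4`, i.e. for all
  114 sealed census faces.

Nothing geometric is built; every statement is about coordinate wedges on the finite `G`-set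
`⊔_k G ⧸ rstab (Φ k)`.  Nothing here says anything about the status of the Hodge conjecture for CM
abelian varieties, which is NOT proved.
-/

set_option autoImplicit false

open Finset Module
open scoped Pointwise

namespace HodgeRepro.RouteC

open CMHodgeOn

section Coset

variable {G : Type*} [Group G] [DecidableEq G] [Fintype G] {ι J : Type*} [Fintype ι] [DecidableEq ι]
  [Fintype J] [DecidableEq J]

omit [Fintype G] [Fintype ι] [DecidableEq ι] in
/-- Membership of a coset point in a conjugate of the descended type: `⟨k, y⟩ ∈ g • cosetType Φ ↔
g⁻¹ y ∈ Φ k`. -/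
theorem cosetMap_mem_smul_cosetType_iff (Φ : J → Finset G) (g : G) (k : J) (y : G) :
    cosetMap Φ (k, y) ∈ g • cosetType Φ ↔ g⁻¹ * y ∈ Φ k := by
  have hequiv : g⁻¹ • cosetMap Φ (k, y) = cosetMap Φ (k, g⁻¹ * y) :=
    ((isTypeMap_cosetMap Φ).equivariant k g⁻¹ y).symm
  rw [Finset.mem_smul_finset]
  constructor
  · rintro ⟨z, hz, hzx⟩
    have hz' : z = cosetMap Φ (k, g⁻¹ * y) := by
      rw [← hequiv, ← hzx]
      exact (inv_smul_smul g z).symm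
    rw [hz'] at hz
    exact ((isTypeMap_cosetMap Φ).mem_iff k _).1 hz
  · intro h
    refine ⟨cosetMap Φ (k, g⁻¹ * y), ((isTypeMap_cosetMap Φ).mem_iff k _).2 h, ?_⟩
    rw [← hequiv]
    exact smul_inv_smul g _

omit [Fintype ι] [DecidableEq ι] in
/-- **A balanced pair of `cosetMap Φ (U_σ)` comes from complementary corners.** -/
theorem eq_compl_of_balanced_pair_coset (Φ : J → Finset G) (cls : ι → J) (tw : ι → G) (σ : G)
    {i i' : ι} (hne : cosetMap Φ (cls i, σ * (tw i)⁻¹) ≠ cosetMap Φ (cls i', σ * (tw i')⁻¹))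
    (hbal : ∀ g : G, (univ.image (fun b : Fin 2 =>
      ![cosetMap Φ (cls i, σ * (tw i)⁻¹), cosetMap Φ (cls i', σ * (tw i')⁻¹)] b) ∩ g • cosetType Φ).card = 1) :
    corner Φ cls tw i' = (corner Φ cls tw i)ᶜ := by
  have hinj : Function.Injective fun b : Fin 2 =>
      ![cosetMap Φ (cls i, σ * (tw i)⁻¹), cosetMap Φ (cls i', σ * (tw i')⁻¹)] b := by
    intro a b hab
    fin_cases a <;> fin_cases b <;> simp_all
  ext τ
  have h := (card_image_pair_inter_eq_one_iff hinj _).1 (hbal (σ * τ⁻¹))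
  simp only [Matrix.cons_val_zero, Matrix.cons_val_one, Matrix.cons_val_fin_one,
    cosetMap_mem_smul_cosetType_iff] at h
  simp only [mul_inv_rev, inv_inv, mul_assoc, inv_mul_cancel_left] at h
  rw [mem_compl, mem_corner, mem_corner]
  exact ⟨fun h1 h2 => (h.1 h2) h1, fun h1 => by_contra fun h2 => h1 (h.2 h2)⟩

omit [DecidableEq ι] in
/-- **The reduced line of a face is exceptional on the coset `G`-set of `B_red`** (`k ≥ 1`): with no two
corners complementary and `cosetMap Φ` injective on `U_σ`, the wedge of `cosetMap Φ (U_σ)` is not a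
`k`-fold product of divisor classes of `B_red`. -/
theorem coordWedgeOn_cosetEnum_notMem_divisorPowerIn {k : ℕ} (hk : 0 < k) (e : Fin (2 * k) ≃ ι)
    (Φ : J → Finset G) {cls : ι → J} {tw : ι → G} (hinj : Function.Injective fun i => (cls i, tw i))
    (hnc : ∀ i i', corner Φ cls tw i' ≠ (corner Φ cls tw i)ᶜ) (σ : G)
    (hρ : Set.InjOn (cosetMap Φ) (reducedSet cls tw σ)) :
    coordWedgeOn (2 * k) (cosetEnum Φ cls tw e σ) ∉
      divisorPowerIn (fun g : G => g • cosetType Φ) k := by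
  intro h
  obtain ⟨s, hs, hrange⟩ := exists_isBalancedPairing_of_mem_divisorPowerIn _
    (cosetEnum_injective Φ hinj e σ hρ) h
  have hmem : ∀ b, ∃ i, cosetMap Φ (cls i, σ * (tw i)⁻¹) = s ⟨0, hk⟩ b := by
    intro b
    have : s ⟨0, hk⟩ b ∈ Set.range (cosetEnum Φ cls tw e σ) := by
      rw [← hrange]
      exact (mem_range_concatPairs s _).2 ⟨⟨0, hk⟩, b, rfl⟩
    obtain ⟨a, ha⟩ := this
    exact ⟨e a, ha⟩
  obtain ⟨i, hi⟩ := hmem 0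
  obtain ⟨i', hi'⟩ := hmem 1
  have hpair : (fun b : Fin 2 =>
      ![cosetMap Φ (cls i, σ * (tw i)⁻¹), cosetMap Φ (cls i', σ * (tw i')⁻¹)] b) = s ⟨0, hk⟩ := by
    funext b
    fin_cases b
    · exact hi
    · exact hi'
  have hne : cosetMap Φ (cls i, σ * (tw i)⁻¹) ≠ cosetMap Φ (cls i', σ * (tw i')⁻¹) := by
    intro h0
    have := (hs ⟨0, hk⟩).1 (a₁ := 0) (a₂ := 1) (by rw [← hi, ← hi']; exact h0)
    exact absurd this (by decide)
  refine hnc i i' (eq_compl_of_balanced_pair_coset Φ cls tw σ hne fun g => ?_)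
  rw [hpair]
  exact (hs ⟨0, hk⟩).2 g

end Coset

/-! ### The faces -/

section Faces

variable {G : Type*} [Group G] [DecidableEq G] [Fintype G]

/-- **The reduced lines of a rank-four face are exceptional on the coset `G`-set of `B_red`**: for a face
record passing its checks in degree `> 4` (distinct corners make `cosetMap` injective on `U_σ`, gen 0's
`injOn_cosetMap_reducedSet_of_injective`), the class Lemma R hands to C5′ on the CM-algebra side is not a
product of two divisor classes of `B_red`. -/
theorem FaceData.coset_exceptional {c : G} (hc : IsComplexConj c) (D : FaceData G) (hok : D.Ok c)
    (h4 : 4 < Fintype.card G) (σ : G) :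
    coordWedgeOn (2 * 2) (cosetEnum D.reps D.cls D.tw (Equiv.refl (Fin (2 * 2))) σ) ∉
      divisorPowerIn (fun g : G => g • cosetType D.reps) 2 := by
  have hcorner : Function.Injective (corner D.reps D.cls D.tw) := hok.2.2.2.1 ▸ hok.2.2.2.2.1
  refine coordWedgeOn_cosetEnum_notMem_divisorPowerIn (by norm_num) _ D.reps hok.2.2.2.2.2 ?_ σ
    (injOn_cosetMap_reducedSet_of_injective D.reps D.cls D.tw hcorner σ)
  intro i i'
  rw [← hok.2.2.2.1]
  exact faceCorners_ne_compl hc hok.1 hok.2.2.1 h4 i i'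

end Faces

end HodgeRepro.RouteC
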